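import Mathlib.Data.ZMod.Basic
import Literature.LinearAlgebra.Matrix.PermanentBypass
import Literature.LinearAlgebra.Matrix.PermanentEntryExpansion
import Literature.LinearAlgebra.Matrix.PermanentZeroOneLift
import HarnessLib

/-!
# From `{-1,0,1,2,3}`-matrices to `0/1`-matrices: Valiant's Lemma 3.3 with one modulus (closed form)

Valiant 1979 (*The complexity of computing the permanent*, TCS 8), Lemma 3.3 and Prop. 3.4
(pp. 193–194): the permanent of a small-integer matrix is recovered from permanents of
`0/1`-matrices — negative entries are removed by working modulo a number, weights `> 1` by
subgraphs. Valiant uses the Chinese remainder theorem over small primes; the single-modulus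
variant (Papadimitriou 1994, proof of Thm. 18.3) replaces `-1` by `2^q ≡ -1 (mod 2^q + 1)` and
realises the weight `2^q` by a chain of doubling gadgets. With the tournament gadgets of
`PermanentBypass.lean` (`Matrix.multiSlot`, `Matrix.permanent_multiSlot`) this file gives the
whole step in CLOSED FORM, as needed by a reduction machine. Relation to the sibling
`PermanentZeroOneLift.lean` (same gadgets, one slot per entry `entrySlots`, `slotMatrix` on a ZERO
base matrix, entries `{-1, 0, 1}` via `liftAct`): here the entries `2, 3` of Valiant's matrices
(`{-1,0,1,2,3}`, Lemma 3.1) are needed, so the gadgets sit on the NONZERO `0/1` base `M.map baseOf`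
(`3 = 1 + 2`), and the new content is the flat, division-with-remainder closed form of the result:

* `baseOf a ∈ {0,1}`, `actOf q a` (number of active tournament nodes) and `liftNeg q a`
  (`-1 ↦ 2^q`), with `baseOf a + slotWeight (actOf q a) = liftNeg q a` on `{-1,0,1,2,3}`;
* `expand M q` — the `0/1` matrix on `Fin n ⊕ Fin (n·n) × Fin (q+2)`: one tournament slot for
  EVERY entry `(u, v) = (s / n, s mod n)` of `M` (inert when `M u v ∈ {0, 1}`), so that the layout
  does not depend on the data; `permanent_expand : per (expand M q) = per (M.map (liftNeg q))`,
  `expand_zero_one` (entries are `0/1`), `permanent_expand_nonneg`;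
* `permanent_liftNeg_emod : per (M.map (liftNeg q)) ≡ per M (mod 2^q + 1)` and
  `permanent_expand_emod`; hence `emod_permanent_expand_eq : per M = per (expand M q) mod (2^q+1)`
  whenever `0 ≤ per M ≤ 2^q`;
* the flat layout `flat f n q` on `Fin (n + n·n·(q+2))` of the expansion of the matrix with total
  entry function `f : ℕ → ℕ → ℤ`, and its closed form `b01 f n q x y` by division with remainder
  (`flat_apply`).

## References

* L. G. Valiant, *The complexity of computing the permanent*, Theoret. Comput. Sci. 8 (1979)
  189–201, Lemma 3.3 and Prop. 3.4 (pp. 193–194, proof of Lemma 3.3 pp. 196–197).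
* C. H. Papadimitriou, *Computational Complexity*, Addison-Wesley 1994, Thm. 18.3 (proof).
-/

namespace Literature.LinearAlgebra.Matrix

open Finset _root_.Matrix

/-! ### The entry data -/

/-- The `0/1` part of an entry: `1 ↦ 1`, `3 ↦ 1` (`= 1 + 2`), everything else `↦ 0`. [cite: Valiant1979, Lemma 3.3] -/
def baseOf (a : ℤ) : ℤ := if a = 1 ∨ a = 3 then 1 else 0

/-- The number of active tournament nodes of an entry: `-1 ↦ q + 1` (weight `2^q`), `2, 3 ↦ 2`
(weight `2`), everything else `↦ 0`. [cite: Papadimitriou1994, Thm. 18.3 (proof)] -/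
def actOf (q : ℕ) (a : ℤ) : ℕ := if a = -1 then q + 1 else if a = 2 ∨ a = 3 then 2 else 0

/-- Lifting `-1` to `2^q` (`≡ -1 (mod 2^q + 1)`). [cite: Papadimitriou1994, Thm. 18.3 (proof)] -/
def liftNeg (q : ℕ) (a : ℤ) : ℤ := if a = -1 then 2 ^ q else a

/-- `baseOf a ∈ {0, 1}`. [folklore] -/
theorem baseOf_zero_one (a : ℤ) : baseOf a = 0 ∨ baseOf a = 1 := by
  unfold baseOf; split_ifs <;> simp

/-- `actOf q a ≤ q + 2`. [folklore] -/
theorem actOf_le (q : ℕ) (a : ℤ) : actOf q a ≤ q + 2 := by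
  unfold actOf; split_ifs <;> omega

/-- `0 ≤ liftNeg q a` for `a ∈ {-1, 0, 1, 2, 3}`. [folklore] -/
theorem liftNeg_nonneg (q : ℕ) {a : ℤ} (ha : a = -1 ∨ a = 0 ∨ a = 1 ∨ a = 2 ∨ a = 3) : 0 ≤ liftNeg q a := by
  rcases ha with rfl | rfl | rfl | rfl | rfl <;> simp [liftNeg]

/-- **The decomposition of an entry**: `baseOf a + slotWeight (actOf q a) = liftNeg q a` on
`{-1, 0, 1, 2, 3}` (`-1 = 0 + 2^q` modulo `2^q+1`, `2 = 0 + 2`, `3 = 1 + 2`). [cite: Valiant1979, Lemma 3.3] -/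
theorem baseOf_add_slotWeight (q : ℕ) {a : ℤ} (ha : a = -1 ∨ a = 0 ∨ a = 1 ∨ a = 2 ∨ a = 3) :
    baseOf a + slotWeight ℤ (actOf q a) = liftNeg q a := by
  rcases ha with rfl | rfl | rfl | rfl | rfl <;> simp [baseOf, actOf, slotWeight, liftNeg]

/-! ### The expansion -/

section Expand

variable {n : ℕ} (M : Matrix (Fin n) (Fin n) ℤ) (q : ℕ)

/-- The slots: one for every entry `(s / n, s mod n)`, with the activity of that entry
(`entrySlots` of `PermanentZeroOneLift.lean` with `act = actOf q ∘ M`). [cite: Valiant1979, Lemma 3.3] -/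
def slotsOf : Fin (n * n) → Slot (Fin n) := entrySlots fun i j => actOf q (M i j)

/-- **The `0/1` expansion** of `M` with parameter `q`: the tournament gadgets of all slots
attached to the `0/1` part `M.map baseOf`. [cite: Valiant1979, Lemma 3.3] -/
def expand : Matrix (Fin n ⊕ Fin (n * n) × Fin (q + 2)) (Fin n ⊕ Fin (n * n) × Fin (q + 2)) ℤ :=
  multiSlot (M.map baseOf) (q + 2) (slotsOf M q)

/-- The simulated matrix of the expansion is `M` with `-1 ↦ 2^q`. [cite: Valiant1979, Lemma 3.3] -/
theorem addSlots_slotsOf (hM : ∀ i j, M i j = -1 ∨ M i j = 0 ∨ M i j = 1 ∨ M i j = 2 ∨ M i j = 3) :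
    addSlots (M.map baseOf) (slotsOf M q) = M.map (liftNeg q) := by
  ext r c
  simp only [addSlots, Matrix.map_apply, slotsOf, entrySlots]
  rw [Finset.sum_eq_single (finProdFinEquiv (r, c))]
  · simp [baseOf_add_slotWeight q (hM r c)]
  · intro s _ hs
    rw [if_neg]
    rintro ⟨hr, hc⟩
    apply hs
    rw [← Equiv.apply_symm_apply finProdFinEquiv s, hr, hc]
  · intro h; exact absurd (Finset.mem_univ _) h

/-- **`per (expand M q) = per (M with -1 ↦ 2^q)`** (Valiant 1979, Lemma 3.3: "`Perm A = Perm h(A)`"). [cite: Valiant1979, Lemma 3.3] -/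
theorem permanent_expand (hM : ∀ i j, M i j = -1 ∨ M i j = 0 ∨ M i j = 1 ∨ M i j = 2 ∨ M i j = 3) :
    (expand M q).permanent = (M.map (liftNeg q)).permanent := by
  rw [expand, permanent_multiSlot _ _ _ (fun s => actOf_le q _), addSlots_slotsOf M q hM]

/-- **The expansion is a `0/1` matrix.** [cite: Valiant1979, Lemma 3.3] -/
theorem expand_zero_one (x y : Fin n ⊕ Fin (n * n) × Fin (q + 2)) :
    expand M q x y = 0 ∨ expand M q x y = 1 := by
  rcases x with r | ⟨s, z⟩ <;> rcases y with c | ⟨s', z'⟩ <;> simp only [expand, multiSlot, Matrix.map_apply]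
  · exact baseOf_zero_one _
  · split_ifs <;> simp
  · split_ifs <;> simp
  · split_ifs <;> simp

/-- The expansion has a nonnegative permanent. [folklore] -/
theorem permanent_expand_nonneg : 0 ≤ (expand M q).permanent :=
  Matrix.permanent_nonneg_of_nonneg _ fun x y => by rcases expand_zero_one M q x y with h | h <;> simp [h]

/-! ### The modulus `2^q + 1` -/

/-- `2^q = -1` in `ℤ/(2^q+1)`. [cite: Papadimitriou1994, Thm. 18.3 (proof)] -/
theorem two_pow_eq_neg_one (q : ℕ) : (2 : ZMod (2 ^ q + 1)) ^ q = -1 := by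
  have h : ((2 ^ q + 1 : ℕ) : ZMod (2 ^ q + 1)) = 0 := ZMod.natCast_self _
  push_cast at h
  exact eq_neg_of_add_eq_zero_left h

/-- The permanent commutes with ring homomorphisms applied entrywise (local copy of the tree's
`Matrix.permanent_map_ringHom` of `AlgebraicComplexity/PermanentCompleteness.lean`, not imported
here). [folklore] -/
private theorem permanent_map_ringHom' {ι : Type*} [DecidableEq ι] [Fintype ι] {R S : Type*}
    [CommSemiring R] [CommSemiring S] (f : R →+* S) (A : Matrix ι ι R) :
    (A.map f).permanent = f A.permanent := by
  simp [Matrix.permanent, map_sum, map_prod]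

/-- **`per (M with -1 ↦ 2^q) ≡ per M (mod 2^q + 1)`** (the permanent is a polynomial in the
entries and `2^q ≡ -1`). [cite: Papadimitriou1994, Thm. 18.3 (proof)] -/
theorem permanent_liftNeg_emod :
    (M.map (liftNeg q)).permanent % (2 ^ q + 1 : ℕ) = M.permanent % (2 ^ q + 1 : ℕ) := by
  rw [← ZMod.intCast_eq_intCast_iff']
  have key : ∀ A : Matrix (Fin n) (Fin n) ℤ,
      ((A.permanent : ℤ) : ZMod (2 ^ q + 1)) = (A.map (Int.castRingHom (ZMod (2 ^ q + 1)))).permanent :=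
    fun A => by rw [permanent_map_ringHom']; rfl
  rw [key, key, Matrix.map_map]
  congr 1
  ext i j
  simp only [Matrix.map_apply, Function.comp_apply, eq_intCast, liftNeg]
  split_ifs with h
  · rw [h]; push_cast; rw [two_pow_eq_neg_one]
  · rfl

/-- **`per (expand M q) ≡ per M (mod 2^q + 1)`.** [cite: Valiant1979, Prop. 3.4] -/
theorem permanent_expand_emod (hM : ∀ i j, M i j = -1 ∨ M i j = 0 ∨ M i j = 1 ∨ M i j = 2 ∨ M i j = 3) :
    (expand M q).permanent % (2 ^ q + 1 : ℕ) = M.permanent % (2 ^ q + 1 : ℕ) := by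
  rw [permanent_expand M q hM, permanent_liftNeg_emod]

/-- **Recovering the permanent**: if `0 ≤ per M ≤ 2^q` then `per M = per (expand M q) mod (2^q+1)`. [cite: Valiant1979, Prop. 3.4] -/
theorem emod_permanent_expand_eq (hM : ∀ i j, M i j = -1 ∨ M i j = 0 ∨ M i j = 1 ∨ M i j = 2 ∨ M i j = 3)
    (h0 : 0 ≤ M.permanent) (hq : M.permanent ≤ 2 ^ q) :
    (expand M q).permanent % (2 ^ q + 1 : ℕ) = M.permanent := by
  rw [permanent_expand_emod M q hM]
  exact Int.emod_eq_of_lt h0 (by push_cast; omega)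

end Expand

/-! ### The flat layout and its closed form -/

section Flat

/-- The flat index layout: the `n` original indices first, then the gadget node `z` of slot `s`
at `n + s (q+2) + z` (`q + 2` nodes per slot, of which at most `q + 1` are active). [folklore] -/
def flatEquiv (n q : ℕ) : Fin (n + n * n * (q + 2)) ≃ Fin n ⊕ Fin (n * n) × Fin (q + 2) :=
  finSumFinEquiv.symm.trans (Equiv.sumCongr (Equiv.refl (Fin n)) finProdFinEquiv.symm)

/-- `flatEquiv` on an original index. [folklore] -/
theorem flatEquiv_of_lt (n q : ℕ) (x : Fin (n + n * n * (q + 2))) (h : x.val < n) :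
    flatEquiv n q x = Sum.inl ⟨x.val, h⟩ := by
  have hx : x = Fin.castAdd (n * n * (q + 2)) ⟨x.val, h⟩ := Fin.ext rfl
  rw [show flatEquiv n q x = flatEquiv n q (Fin.castAdd (n * n * (q + 2)) ⟨x.val, h⟩) from congrArg _ hx,
    flatEquiv, Equiv.trans_apply, finSumFinEquiv_symm_apply_castAdd]
  rfl

/-- `flatEquiv` on a gadget node: slot `(x - n) / (q+2)`, node `(x - n) mod (q+2)`. [folklore] -/
theorem flatEquiv_of_le (n q : ℕ) (x : Fin (n + n * n * (q + 2))) (h : n ≤ x.val) :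
    ∃ (hs : (x.val - n) / (q + 2) < n * n) (hz : (x.val - n) % (q + 2) < q + 2),
      flatEquiv n q x = Sum.inr (⟨(x.val - n) / (q + 2), hs⟩, ⟨(x.val - n) % (q + 2), hz⟩) := by
  have hlt : x.val - n < n * n * (q + 2) := by have := x.isLt; omega
  have hx : x = Fin.natAdd n ⟨x.val - n, hlt⟩ := Fin.ext (by simp; omega)
  refine ⟨by rw [Nat.div_lt_iff_lt_mul (by omega)]; exact hlt, Nat.mod_lt _ (by omega), ?_⟩
  rw [show flatEquiv n q x = flatEquiv n q (Fin.natAdd n ⟨x.val - n, hlt⟩) from congrArg _ hx,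
    flatEquiv, Equiv.trans_apply, finSumFinEquiv_symm_apply_natAdd]
  simp only [Equiv.sumCongr_apply, Sum.map_inr, finProdFinEquiv_symm_apply, Sum.inr.injEq, Prod.mk.injEq]
  exact ⟨Fin.ext (by simp), Fin.ext (by simp)⟩

/-- The matrix with total entry function `f`, on `Fin n`. [folklore] -/
def ofFn (f : ℕ → ℕ → ℤ) (n : ℕ) : Matrix (Fin n) (Fin n) ℤ := Matrix.of fun i j => f i.val j.val

/-- **The flat `0/1` matrix** of the entry function `f` (size `n`, parameter `q`), on
`Fin (n + n² (q+2))`. [cite: Valiant1979, Lemma 3.3] -/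
def flat (f : ℕ → ℕ → ℤ) (n q : ℕ) : Matrix (Fin (n + n * n * (q + 2))) (Fin (n + n * n * (q + 2))) ℤ :=
  (expand (ofFn f n) q).submatrix (flatEquiv n q) (flatEquiv n q)

/-- **The closed form of the flat `0/1` matrix** by division with remainder: original indices
`x < n`; gadget node `x ≥ n` of slot `s = (x-n)/(q+2)` (entry `(s/n, s mod n)` of `f`), position
`z = (x-n) mod (q+2)`; the tournament pattern of `Matrix.multiSlot`. [cite: Valiant1979, Lemma 3.3] -/
def b01 (f : ℕ → ℕ → ℤ) (n q x y : ℕ) : ℤ :=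
  if x < n then
    (if y < n then baseOf (f x y)
     else if x = (y - n) / (q + 2) / n ∧ (y - n) % (q + 2) = 0 ∧
        0 < actOf q (f ((y - n) / (q + 2) / n) ((y - n) / (q + 2) % n)) then 1 else 0)
  else
    (if y < n then
      (if y = (x - n) / (q + 2) % n ∧
          (x - n) % (q + 2) < actOf q (f ((x - n) / (q + 2) / n) ((x - n) / (q + 2) % n)) then 1 else 0)
     else if (x - n) / (q + 2) = (y - n) / (q + 2) then
       (if (x - n) % (q + 2) = (y - n) % (q + 2) then 1
        else if (x - n) % (q + 2) < (y - n) % (q + 2) ∧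
          (y - n) % (q + 2) < actOf q (f ((x - n) / (q + 2) / n) ((x - n) / (q + 2) % n)) then 1 else 0)
     else 0)

/-- **`flat f n q = b01 f n q`** entrywise. [cite: Valiant1979, Lemma 3.3] -/
theorem flat_apply (f : ℕ → ℕ → ℤ) (n q : ℕ) (x y : Fin (n + n * n * (q + 2))) :
    flat f n q x y = b01 f n q x.val y.val := by
  unfold flat b01
  rw [Matrix.submatrix_apply]
  by_cases hx : x.val < n <;> by_cases hy : y.val < n
  · rw [flatEquiv_of_lt n q x hx, flatEquiv_of_lt n q y hy, if_pos hx, if_pos hy]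
    rfl
  · obtain ⟨hs, hz, hye⟩ := flatEquiv_of_le n q y (not_lt.1 hy)
    rw [flatEquiv_of_lt n q x hx, hye, if_pos hx, if_neg hy]
    simp only [expand, multiSlot, slotsOf, entrySlots, finProdFinEquiv_symm_apply, ofFn, Matrix.of_apply, Fin.ext_iff,
      Fin.coe_divNat, Fin.coe_modNat]
  · obtain ⟨hs, hz, hxe⟩ := flatEquiv_of_le n q x (not_lt.1 hx)
    rw [hxe, flatEquiv_of_lt n q y hy, if_neg hx, if_pos hy]
    simp only [expand, multiSlot, slotsOf, entrySlots, finProdFinEquiv_symm_apply, ofFn, Matrix.of_apply, Fin.ext_iff,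
      Fin.coe_divNat, Fin.coe_modNat]
  · obtain ⟨hs, hz, hxe⟩ := flatEquiv_of_le n q x (not_lt.1 hx)
    obtain ⟨hs', hz', hye⟩ := flatEquiv_of_le n q y (not_lt.1 hy)
    rw [hxe, hye, if_neg hx, if_neg hy]
    simp only [expand, multiSlot, slotsOf, entrySlots, finProdFinEquiv_symm_apply, ofFn, Matrix.of_apply, Fin.ext_iff,
      Fin.coe_divNat, Fin.coe_modNat, Fin.lt_def]

/-- **The flat matrix is `0/1`.** [cite: Valiant1979, Lemma 3.3] -/
theorem flat_zero_one (f : ℕ → ℕ → ℤ) (n q : ℕ) (x y : Fin (n + n * n * (q + 2))) :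
    flat f n q x y = 0 ∨ flat f n q x y = 1 :=
  expand_zero_one _ _ _ _

/-- **The flat matrix computes `per` modulo `2^q + 1`**: for `f` with values in `{-1,0,1,2,3}` on
`n × n` and `0 ≤ per (ofFn f n) ≤ 2^q`,
`per (ofFn f n) = per (flat f n q) mod (2^q + 1)`. [cite: Valiant1979, Prop. 3.4] -/
theorem emod_permanent_flat_eq (f : ℕ → ℕ → ℤ) (n q : ℕ)
    (hf : ∀ i j : Fin n, f i j = -1 ∨ f i j = 0 ∨ f i j = 1 ∨ f i j = 2 ∨ f i j = 3)
    (h0 : 0 ≤ (ofFn f n).permanent) (hq : (ofFn f n).permanent ≤ 2 ^ q) :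
    (flat f n q).permanent % (2 ^ q + 1 : ℕ) = (ofFn f n).permanent := by
  rw [flat, Matrix.permanent_submatrix_equiv]
  exact emod_permanent_expand_eq _ q (fun i j => hf i j) h0 hq

/-- The flat matrix has a nonnegative permanent. [folklore] -/
theorem permanent_flat_nonneg (f : ℕ → ℕ → ℤ) (n q : ℕ) : 0 ≤ (flat f n q).permanent := by
  rw [flat, Matrix.permanent_submatrix_equiv]
  exact permanent_expand_nonneg _ _

end Flat

end Literature.LinearAlgebra.Matrix
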